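import Literature.Analysis.Complex.RootsOfUnityComplementRadiusSymmetrization
import Literature.Analysis.Complex.RootsOfUnityComplementFirstRingZero
import Literature.NumberTheory.Automorphic.UnboundedDenominatorsDimensionBoundProofs
import HarnessLib

/-!
# The conformal radius of `ℂ ∖ μ_N`: `‖F_N′(0)‖ ≥ 16^{1/N}(1 + A/N³)` (CDT Theorem 5.1.4, lower bound)

`Literature/Analysis/Complex/RootsOfUnityComplementRadiusLowerBound.lean` — PROOF-ONLY (no definition,
no named fact). Brick B4 (assembly) of the elementary route recorded in
`Summits/…/Cruxes/StarredOptimalManinUnitFiveSeven/Lines/cdt_thm1-radius-elementary-route-g39.md`.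

F. Calegari, V. Dimitrov, Y. Tang, *The unbounded denominators conjecture*, J. Amer. Math. Soc. 38
(2025), Theorem 5.1.4: the universal covering map `F_N : D(0,1) → ℂ ∖ μ_N`, `F_N(0) = 0`, has
`|F_N′(0)| = 16^{1/N}(1 + ζ(3)/(2N³) + O(N⁻⁵))` (exact value in Γ-functions via the Schwarz triangle
map of the `(N, ∞, ∞)` triangle group). What their Proposition 3.0.1 consumes is the LOWER BOUND
`|F_N′(0)| ≥ 16^{1/N}(1 + A/N³)` for an absolute `A > 0`; this is
★ `exists_radius_lower_bound_compl_rootsOfUnity` below, for EVERY `N ≥ 1` and every holomorphic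
covering `F : 𝔻 → {z | zᴺ ≠ 1}` with `F(0) = 0`, with `A = 1/16384`. Proof: B2
(`sixteen_le_pow_norm_deriv_mul_of_zero`: `16 ≤ ‖F′(0)‖ᴺ g(‖z₁‖ᴺ)` for a nonzero zero `z₁`) + B3
(`exists_zero_norm_le_of_isCoveringMap_compl_rootsOfUnity`: a zero with `‖z₁‖ ≤ 1 − 1/(16N²)`) + the
calculus `g(r) = 2r log(1/r)/(1−r²) ≤ 1 − (1−r)²/8` (`two_mul_mul_log_inv_le`).

Consequence (with `UnboundedDenominatorsDimensionBoundProofs.lean`, p816153): the analytic half of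
CDT Proposition 3.0.1 — `dim ≤ C N³ log N` for admissible families — is now unconditional
(`CalegariDimitrovTang2025_unboundedDenominators.dim_le_unconditional`). Nothing here proves CDT
Theorem 1.0.1 (the algebraization of Prop. 3.0.1 and §§4, 6.3 remain).

## References
* [CalegariDimitrovTang2025] F. Calegari, V. Dimitrov, Y. Tang, J. Amer. Math. Soc. 38 (2025),
  Theorem 5.1.4, Proposition 3.0.1.
* [Ahlfors1973] L. V. Ahlfors, *Conformal invariants*, §1-6.
-/

noncomputable section

open Set Metric Filter Real
open scoped Topology

namespace Literature.Analysis.Complex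

open _root_.Complex

/-! ### §1 Calculus: `g(r) = 2 r log(1/r)/(1 − r²) ≤ 1 − (1 − r)²/8` -/

/-- `−log(1 − u) ≥ u + u²/2` for `0 ≤ u < 1` (two terms of the logarithmic series, all of whose terms
are non-negative). [folklore] -/
private theorem add_sq_div_two_le_neg_log_one_sub {u : ℝ} (hu0 : 0 ≤ u) (hu1 : u < 1) :
    u + u ^ 2 / 2 ≤ -Real.log (1 - u) := by
  have h := Real.hasSum_pow_div_log_of_abs_lt_one (x := u) (by rw [abs_of_nonneg hu0]; exact hu1)
  have hs := sum_le_hasSum (Finset.range 2) (fun n _ ↦ by positivity) h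
  have h2 : u + u ^ 2 / (1 + 1) ≤ -Real.log (1 - u) := by simpa [Finset.sum_range_succ] using hs
  norm_num at h2
  exact h2

/-- The auxiliary function `G(u) = u(2 − u)(1 − u²/8) + 2(1 − u) log(1 − u)` is monotone on `[0, 1)`
(its derivative `−2u − (3/4)u² + u³/2 − 2 log(1 − u)` is `≥ u²/4 + u³/2 ≥ 0`). [folklore] -/
private theorem monotoneOn_aux :
    MonotoneOn (fun u : ℝ ↦ u * (2 - u) * (1 - u ^ 2 / 8) + 2 * (1 - u) * Real.log (1 - u))
      (Ico (0 : ℝ) 1) := by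
  have hint : interior (Ico (0 : ℝ) 1) = Ioo 0 1 := interior_Ico
  refine monotoneOn_of_deriv_nonneg (convex_Ico 0 1) ?_ ?_ ?_
  · refine ContinuousOn.add (by fun_prop) (ContinuousOn.mul (by fun_prop) ?_)
    exact (Real.continuousOn_log.comp (by fun_prop) fun u hu ↦ by
      simp only [mem_Ico] at hu; simp only [mem_compl_iff, mem_singleton_iff]; linarith)
  · rw [hint]
    intro u hu
    have hu1 : 1 - u ≠ 0 := by simp only [mem_Ioo] at hu; linarith
    exact (((differentiableAt_id.mul (differentiableAt_const _ |>.sub differentiableAt_id)).mul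
      ((differentiableAt_const _).sub ((differentiableAt_id.pow 2).div_const 8))).add
      (((differentiableAt_const _).sub differentiableAt_id |>.const_mul 2).mul
        (((differentiableAt_const _).sub differentiableAt_id).log hu1))).differentiableWithinAt
  · rw [hint]
    intro u hu
    simp only [mem_Ioo] at hu
    have hu1 : 1 - u ≠ 0 := by linarith
    -- compute the derivative
    have hd : HasDerivAt (fun u : ℝ ↦ u * (2 - u) * (1 - u ^ 2 / 8) + 2 * (1 - u) * Real.log (1 - u))
        ((1 * (2 - u) + u * (0 - 1)) * (1 - u ^ 2 / 8) + u * (2 - u) * (0 - 2 * u / 8) +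
          (2 * (0 - 1) * Real.log (1 - u) + 2 * (1 - u) * ((0 - 1) / (1 - u)))) u := by
      have h1 : HasDerivAt (fun u : ℝ ↦ 1 - u) (0 - 1) u := (hasDerivAt_const u 1).sub (hasDerivAt_id u)
      have h2 : HasDerivAt (fun u : ℝ ↦ 2 - u) (0 - 1) u := (hasDerivAt_const u 2).sub (hasDerivAt_id u)
      have h3 : HasDerivAt (fun u : ℝ ↦ 1 - u ^ 2 / 8) (0 - 2 * u / 8) u := by
        have h' : HasDerivAt (fun u : ℝ ↦ u ^ 2 / 8) (2 * u / 8) u := by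
          simpa using ((hasDerivAt_id u).pow 2).div_const 8
        have := h'.const_sub (1 : ℝ)
        simpa using this
      have hlog : HasDerivAt (fun u : ℝ ↦ Real.log (1 - u)) ((0 - 1) / (1 - u)) u := h1.log hu1
      exact (((hasDerivAt_id u).mul h2).mul h3).add ((h1.const_mul 2).mul hlog)
    rw [hd.deriv]
    have hlog := add_sq_div_two_le_neg_log_one_sub hu.1.le hu.2
    have e : (1 * (2 - u) + u * (0 - 1)) * (1 - u ^ 2 / 8) + u * (2 - u) * (0 - 2 * u / 8) +
          (2 * (0 - 1) * Real.log (1 - u) + 2 * (1 - u) * ((0 - 1) / (1 - u))) =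
        -2 * u - 3 / 4 * u ^ 2 + u ^ 3 / 2 + 2 * (-Real.log (1 - u)) - 2 + 2 - 0 := by
      field_simp
      ring
    rw [e]
    nlinarith [hlog, hu.1, hu.2, sq_nonneg u, mul_pos hu.1 hu.1, mul_pos (mul_pos hu.1 hu.1) hu.1]

/-- **`g(r) = 2 r log(1/r)/(1 − r²) ≤ 1 − (1 − r)²/8` for `0 < r < 1`** (the conformal radius of the
once-punctured disc from its centre in terms of the depth of the puncture). [cite: Ahlfors1973, §1-6] -/
theorem two_mul_mul_log_inv_le {r : ℝ} (hr0 : 0 < r) (hr1 : r < 1) :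
    2 * r * Real.log r⁻¹ / (1 - r ^ 2) ≤ 1 - (1 - r) ^ 2 / 8 := by
  have h1r : 0 < 1 - r ^ 2 := by nlinarith
  rw [div_le_iff₀ h1r]
  -- `G(1 − r) ≥ G(0) = 0`
  have hu : (1 - r) ∈ Ico (0 : ℝ) 1 := ⟨by linarith, by linarith⟩
  have h0 : (0 : ℝ) ∈ Ico (0 : ℝ) 1 := ⟨le_rfl, one_pos⟩
  have hG := monotoneOn_aux h0 hu (by linarith)
  simp only [sub_zero, mul_zero, zero_mul, Real.log_one, add_zero, sub_sub_cancel] at hG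
  rw [Real.log_inv]
  nlinarith [hG]

/-! ### §2 CDT Theorem 5.1.4, lower-bound form -/

/-- ★ **The conformal radius of `ℂ ∖ μ_N` exceeds `16^{1/N}` by a factor `1 + A/N³`
(Calegari–Dimitrov–Tang, Theorem 5.1.4, lower bound; elementary proof).** There is an absolute
constant `A > 0` (here `A = 1/16384`) such that for every `N ≥ 1` and every holomorphic covering map
`F` of `{z | zᴺ ≠ 1}` by the unit disc with `F(0) = 0`:
`16^{1/N} · (1 + A/N³) ≤ ‖F′(0)‖`.
Proof: a nonzero zero `z₁` with `‖z₁‖ ≤ 1 − 1/(16N²)` (B3) gives `‖z₁‖ᴺ ≤ e^{−1/(16N)}`,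
`1 − ‖z₁‖ᴺ ≥ 1/(32N)`, `g(‖z₁‖ᴺ) ≤ 1 − 1/(8192 N²)` (§1), and B2 gives
`‖F′(0)‖ᴺ ≥ 16/(1 − 1/(8192N²)) ≥ 16 e^{A/N²} ≥ 16 (1 + A/N³)ᴺ`.
CDT prove the exact value `16^{1/N}(1 + ζ(3)/(2N³) + O(N⁻⁵))`, not reproduced here.
[cite: CalegariDimitrovTang2025, Theorem 5.1.4] -/
theorem exists_radius_lower_bound_compl_rootsOfUnity :
    ∃ A : ℝ, 0 < A ∧ ∀ (N : ℕ), 0 < N → ∀ (F : ℂ → ℂ)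
      (hFU : MapsTo F (ball (0 : ℂ) 1) {z : ℂ | z ^ N ≠ 1}),
      DifferentiableOn ℂ F (ball (0 : ℂ) 1) → IsCoveringMap hFU.restrict → F 0 = 0 →
      (16 : ℝ) ^ ((N : ℝ)⁻¹) * (1 + A / (N : ℝ) ^ 3) ≤ ‖deriv F 0‖ := by
  refine ⟨1 / 16384, by norm_num, fun N hN F hFU hF hcov hF0 ↦ ?_⟩
  have hNpos : (0 : ℝ) < N := by exact_mod_cast hN
  have hN1 : (1 : ℝ) ≤ N := by exact_mod_cast hN
  -- B3: a zero at depth ≥ 1/(16N²); B2: 16 ≤ ρᴺ g(‖z₁‖ᴺ)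
  obtain ⟨z₁, hz₁, hz₁0, hFz₁, hdepth⟩ :=
    exists_zero_norm_le_of_isCoveringMap_compl_rootsOfUnity hN hF hFU hcov hF0
  have hB2 := sixteen_le_pow_norm_deriv_mul_of_zero hN hF hFU hcov hF0 hz₁ hz₁0 hFz₁
  set ρ : ℝ := ‖deriv F 0‖ with hρ
  set r : ℝ := ‖z₁‖ ^ N with hr
  have hz₁pos : 0 < ‖z₁‖ := norm_pos_iff.2 hz₁0
  have hz₁lt : ‖z₁‖ < 1 := by simpa using hz₁
  have hr0 : 0 < r := pow_pos hz₁pos N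
  have hr1 : r < 1 := pow_lt_one₀ hz₁pos.le hz₁lt hN.ne'
  -- `r ≤ exp(−1/(16N))`, so `1 − r ≥ 1/(32N)`
  have hrexp : r ≤ Real.exp (-(1 / (16 * N))) := by
    have h1 : ‖z₁‖ ≤ Real.exp (-(1 / (16 * (N : ℝ) ^ 2))) := by
      refine hdepth.trans ?_
      have := Real.add_one_le_exp (-(1 / (16 * (N : ℝ) ^ 2)))
      linarith
    calc r = ‖z₁‖ ^ N := rfl
      _ ≤ Real.exp (-(1 / (16 * (N : ℝ) ^ 2))) ^ N := pow_le_pow_left₀ hz₁pos.le h1 N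
      _ = Real.exp (-(1 / (16 * N))) := by
          rw [← Real.exp_nat_mul]; congr 1; field_simp
  have h1r : 1 / (32 * (N : ℝ)) ≤ 1 - r := by
    have hx1 : 1 / (16 * (N : ℝ)) ≤ 1 := by
      rw [div_le_one (by positivity)]; linarith
    have hx0 : 0 ≤ 1 / (16 * (N : ℝ)) := by positivity
    -- `1 − e^{−x} ≥ x/2` on `[0,1]`
    have hexp : Real.exp (-(1 / (16 * (N : ℝ)))) ≤ 1 - (1 / (16 * (N : ℝ))) / 2 := by
      set x : ℝ := 1 / (16 * (N : ℝ)) with hx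
      have e1 : Real.exp (-x) ≤ 1 / (1 + x) := by
        rw [Real.exp_neg, one_div]
        exact inv_anti₀ (by positivity) (by linarith [Real.add_one_le_exp x])
      have e2 : 1 / (1 + x) ≤ 1 - x / 2 := by
        rw [div_le_iff₀ (by positivity)]; nlinarith
      linarith
    have : (1 / (16 * (N : ℝ))) / 2 = 1 / (32 * N) := by ring
    linarith [hrexp]
  -- `g(r) ≤ 1 − (1−r)²/8 ≤ 1 − η`, `η = 1/(8192 N²)`
  set η : ℝ := 1 / (8192 * (N : ℝ) ^ 2) with hη
  have hη0 : 0 < η := by positivity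
  have hg : 2 * r * Real.log r⁻¹ / (1 - r ^ 2) ≤ 1 - η := by
    refine (two_mul_mul_log_inv_le hr0 hr1).trans ?_
    have : η ≤ (1 - r) ^ 2 / 8 := by
      have h2 : (1 / (32 * (N : ℝ))) ^ 2 ≤ (1 - r) ^ 2 := pow_le_pow_left₀ (by positivity) h1r 2
      rw [hη]
      have : (1 / (32 * (N : ℝ))) ^ 2 / 8 = 1 / (8192 * (N : ℝ) ^ 2) := by ring
      linarith
    linarith
  -- `ρᴺ ≥ 16 / (1 − η)`
  have hρpos : 0 < ρ := by
    have : (0 : ℝ) < 16 := by norm_num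
    by_contra hle
    push Not at hle
    have hρ0 : ρ = 0 := le_antisymm hle (norm_nonneg _)
    rw [hρ0, zero_pow hN.ne', zero_mul] at hB2
    linarith
  have hη1 : η ≤ 1 / 8192 := by
    rw [hη]; exact div_le_div_of_nonneg_left (by norm_num) (by norm_num) (by nlinarith)
  have hρN : 16 / (1 - η) ≤ ρ ^ N := by
    rw [div_le_iff₀ (by linarith), mul_comm]
    have hgpos : 0 ≤ 2 * r * Real.log r⁻¹ / (1 - r ^ 2) :=
      div_nonneg (mul_nonneg (by positivity) (Real.log_nonneg ((one_le_inv₀ hr0).2 hr1.le)))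
        (by nlinarith)
    calc (16 : ℝ) ≤ ρ ^ N * (2 * r * Real.log r⁻¹ / (1 - r ^ 2)) := hB2
      _ ≤ ρ ^ N * (1 - η) := by gcongr
      _ = (1 - η) * ρ ^ N := mul_comm _ _
  -- `(1 + A/N³)ᴺ ≤ exp(A/N²) ≤ 1 + 2A/N² = 1 + η ≤ 1/(1 − η)`
  set A : ℝ := 1 / 16384 with hA
  have hA0 : 0 < A := by rw [hA]; norm_num
  have hx0 : 0 ≤ A / (N : ℝ) ^ 2 := div_nonneg hA0.le (by positivity)
  have hx3 : 0 ≤ A / (N : ℝ) ^ 3 := div_nonneg hA0.le (by positivity)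
  have hANle : A / (N : ℝ) ^ 2 ≤ 1 := by
    rw [div_le_one (by positivity)]
    calc A ≤ 1 := by rw [hA]; norm_num
      _ ≤ (N : ℝ) ^ 2 := by nlinarith
  have hpow : (1 + A / (N : ℝ) ^ 3) ^ N ≤ 1 + η := by
    calc (1 + A / (N : ℝ) ^ 3) ^ N ≤ Real.exp (A / (N : ℝ) ^ 3) ^ N :=
          pow_le_pow_left₀ (by linarith) (by linarith [Real.add_one_le_exp (A / (N : ℝ) ^ 3)]) N
      _ = Real.exp (A / (N : ℝ) ^ 2) := by rw [← Real.exp_nat_mul]; congr 1; field_simp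
      _ ≤ 1 + 2 * (A / (N : ℝ) ^ 2) := by
          have h := Real.abs_exp_sub_one_le (x := A / (N : ℝ) ^ 2)
            (by rw [abs_of_nonneg hx0]; exact hANle)
          have h' := (abs_le.1 h).2
          rw [abs_of_nonneg hx0] at h'
          linarith
      _ = 1 + η := by rw [hη, hA]; ring
  have h1η : 1 + η ≤ 1 / (1 - η) := by
    rw [le_div_iff₀ (by linarith)]
    nlinarith
  -- conclude: `(16^{1/N}(1 + A/N³))ᴺ ≤ ρᴺ`
  have hkey : ((16 : ℝ) ^ ((N : ℝ)⁻¹) * (1 + A / (N : ℝ) ^ 3)) ^ N ≤ ρ ^ N := by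
    have h16 : ((16 : ℝ) ^ ((N : ℝ)⁻¹)) ^ N = 16 := by
      rw [← Real.rpow_natCast, ← Real.rpow_mul (by norm_num), inv_mul_cancel₀ hNpos.ne',
        Real.rpow_one]
    rw [mul_pow, h16]
    calc 16 * (1 + A / (N : ℝ) ^ 3) ^ N ≤ 16 * (1 + η) := by gcongr
      _ ≤ 16 * (1 / (1 - η)) := by gcongr
      _ = 16 / (1 - η) := by ring
      _ ≤ ρ ^ N := hρN
  exact le_of_pow_le_pow_left₀ hN.ne' hρpos.le hkey

/-! ### §3 Consequence: CDT Proposition 3.0.1, analytic half, unconditionally -/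

/-- ★ **CDT Proposition 3.0.1, analytic half, UNCONDITIONAL.** There are absolute constants `A > 0`
and `C` such that for all `N ≥ 2` with `A/N³ ≤ 2/9`, every holomorphic covering `F` of
`{z | zᴺ ≠ 1}` by the unit disc with `F(0) = 0`, and every family `f₁, …, f_m ∈ ℚ⟦x⟧` admissible for
`φ = 16^{-1/N} F(r ·)`, `r = 1 − A/(2N³)`, in the sense of CDT Theorem 2.0.1 with `p(x) = xᴺ`
(`x ∈ t + t²ℚ⟦t⟧` with `x(t)ᴺ ∈ ℤ⟦t⟧`, `f_i(x(t)) ∈ ℤ⟦t⟧`, no `ℚ[xᴺ]`-relation, `f_i ∘ φ` holomorphic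
about the closed unit disc): `m ≤ C · N³ · log N`. This is
`CalegariDimitrovTang2025_unboundedDenominators.dim_le_of_radius` (p816153) with its radius
hypothesis DISCHARGED by `exists_radius_lower_bound_compl_rootsOfUnity`.
[cite: CalegariDimitrovTang2025, Proposition 3.0.1, Theorems 2.0.1, 5.1.4, 6.0.1] -/
theorem CalegariDimitrovTang2025_unboundedDenominators.dim_le_unconditional :
    ∃ A C : ℝ, 0 < A ∧ ∀ (N : ℕ), 2 ≤ N → A / (N : ℝ) ^ 3 ≤ 2 / 9 →
      ∀ (F : ℂ → ℂ) (hFU : MapsTo F (ball (0 : ℂ) 1) {z : ℂ | z ^ N ≠ 1}),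
      DifferentiableOn ℂ F (ball (0 : ℂ) 1) → IsCoveringMap hFU.restrict → F 0 = 0 →
      ∀ (φ : ℂ → ℂ), φ = (fun z : ℂ ↦ (((16 : ℝ) ^ (-(N : ℝ)⁻¹) : ℝ) : ℂ) *
          F (((1 - A / (2 * (N : ℝ) ^ 3) : ℝ) : ℂ) * z)) →
      ∀ (m : ℕ) (x : PowerSeries ℚ), PowerSeries.constantCoeff x = 0 → PowerSeries.coeff 1 x = 1 →
      (∃ G : PowerSeries ℤ, G.map (Int.castRingHom ℚ) = x ^ N) →
      ∀ (f : Fin m → PowerSeries ℚ),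
      (∀ Q : Fin m → Polynomial ℚ,
        ∑ i, Polynomial.aeval ((PowerSeries.X : PowerSeries ℚ) ^ N) (Q i) * f i = 0 → ∀ i, Q i = 0) →
      (∀ i, ∃ G : PowerSeries ℤ, G.map (Int.castRingHom ℚ) = (f i).subst x) →
      (∀ i, ∃ g : ℂ → ℂ, AnalyticOnNhd ℂ g (closedBall 0 1) ∧
        ((f i).map (algebraMap ℚ ℂ)).subst
            (PowerSeries.mk fun n ↦ iteratedDeriv n φ 0 / n.factorial)
          = PowerSeries.mk fun n ↦ iteratedDeriv n g 0 / n.factorial) →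
      (m : ℝ) ≤ C * (N : ℝ) ^ 3 * Real.log N := by
  obtain ⟨A, hA, hrad⟩ := exists_radius_lower_bound_compl_rootsOfUnity
  obtain ⟨C, hC⟩ :=
    Literature.NumberTheory.Automorphic.CalegariDimitrovTang2025_unboundedDenominators.dim_le_of_radius hA
  refine ⟨A, C, hA, fun N hN hAN F hFU hF hcov hF0 φ hφ m x hx0 hx1 hxN f hind hint han ↦ ?_⟩
  exact hC N hN hAN F hFU hF hcov hF0 (hrad N (by omega) F hFU hF hcov hF0) φ hφ m x hx0 hx1 hxN f
    hind hint han

end Literature.Analysis.Complex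

end
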